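import Mathlib
import Summits.NavierStokesRegularity.NavierStokesRegularity.Theorems.EulerZoomLiouvillePowerGaugeEulerLiouvilleSelfSimilarKelvin
import HarnessLib.Audit

/-!
# Rung C1 of the crux `EulerZoomLiouville.PowerGaugeEulerLiouville`: the FAR-FIELD KELVIN BOUND
# (self-similar Kelvin law + Jacobian `e^{3γs}` + outgoing trajectories ⇒ an exponential test
# of the far-field vorticity against the energy on transported supports)

Route №10 `EulerZoomLiouville` (NavierStokesRegularity), crux E = stmt-NavierStokesRegularity-19832,
tenure rung C1, registered residue `stub_selfSimilarExtremal`.  Sequel to `…SelfSimilarKelvinFlow`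
(the flow `Φ_s` of `γy + V`) and `…SelfSimilarKelvin` (the torus-averaged Kelvin law
`∫ ⟪V(Φ_s y), DΦ_s(y)B(y)⟫ = e^{(2γ−1)s} ∫ ⟪V, B⟫`).  PROFILE LEVEL, classical profile
(`IsSelfSimilarEulerProfile γ 0 V P`, `V` smooth, `‖V‖ ≤ M`, `‖DV‖ ≤ K`):

* `volume_image_flow`, `setIntegral_norm_comp_flow` — transport bookkeeping:
  `vol(Φ_s A) = e^{3γs} vol(A)`, `∫_A ‖V∘Φ_s‖ = e^{−3γs} ∫_{Φ_s A} ‖V‖`;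
* `abs_integral_inner_le_exp_of_image` — **THE FAR-FIELD KELVIN BOUND**: if `‖DV‖ ≤ ε` beyond
  the radius `R`, `B` is a compactly supported divergence-free field supported in `{|y| ≥ L}`
  with `L − M/γ ≥ R`, and the energy of `V` on the transported support obeys
  `∫_{Φ_s(supp B)} |V|² ≤ C e^{−βγs}`, then
  `|∫ ⟪V, B⟫| ≤ ½‖B‖_∞ (C + vol(supp B)) · e^{(1 − 5γ/2 + ε − βγ/2)s}`
  (Kelvin law, `‖DΦ_s‖ ≤ e^{(γ+ε)s}`, AM–GM on the image with weight `e^{(3γ/2+βγ/2)s}`);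
* `image_subset_annulus` — `Φ_s(supp B)` lies in the dyadic annulus
  `{(L−M/γ)e^{γs} ≤ |x| < 2^N (L−M/γ) e^{γs}}` of FIXED width `N`.

At the energy-conserving endpoint `γ = 2/5` the Kelvin exponent `1 − 5γ/2` VANISHES, so any power
decay `β > 0` of the far energy beats it once `ε < βγ/2`: the sequel `…SelfSimilarKelvinCompactVorticity`
concludes that `curl V` has compact support, and `…SelfSimilarEndpointSmooth` that the member is
trivial.  For `γ > 2/5` (`ρ < 1/2`) the same bound reproduces the extremal growth `L^{1−2ρ}` of
Bronzi–Shvydkoy / the lineage's energy saturation (no new information there).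

WHAT THIS IS NOT: not NS, not E, not rung C1 — an estimate for CLASSICAL profiles.

## References

* P. Constantin, M. Ignatova, V. Vicol, arXiv:2602.17570 (2026), §3.4.1–§3.4.2, Remark 3.6.
  [ConstantinIgnatovaVicol2026Putative]
* D. Chae, R. Shvydkoy, ARMA 209 (2013) = arXiv:1201.6009, §3.1 (dyadic shells), §4 Thm 4.2 (iii).
  [ChaeShvydkoy2013]
-/

noncomputable section

-- flat `Theorems/<Route><Decl>…` files of one crux share the namespace of the crux (tree convention)
set_option linter.dupNamespace false

open MeasureTheory Set Filter Topology Metric Function InnerProductSpace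
open scoped RealInnerProductSpace NNReal ENNReal ContDiff

namespace Summit.NavierStokesRegularity.NavierStokesRegularity.Theorems.PowerGaugeEulerLiouville.Kelvin

open Literature.Analysis Literature.Analysis.FluidPDE

variable {γ : ℝ} {V : EuclideanSpace ℝ (Fin 3) → EuclideanSpace ℝ (Fin 3)}

/-! ### The far-field energy argument -/

/-- AM–GM in the form used for the shell Cauchy–Schwarz: `‖v‖ ≤ ½(λ‖v‖² + λ⁻¹)` for `λ > 0`. [folklore] -/
theorem norm_le_half_mul_sq_add_inv {v : EuclideanSpace ℝ (Fin 3)} {l : ℝ} (hl : 0 < l) :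
    ‖v‖ ≤ (l * ‖v‖ ^ 2 + l⁻¹) / 2 := by
  have h : 0 ≤ l * (‖v‖ - l⁻¹) ^ 2 := by positivity
  have h2 : l * (‖v‖ - l⁻¹) ^ 2 = l * ‖v‖ ^ 2 - 2 * ‖v‖ + l⁻¹ := by
    field_simp
    ring
  nlinarith [h, h2]

/-- **The image of a compact set under `Φ_s` has volume `e^{3γs} vol`** (Jacobian `e^{3γs}`).
[cite: ConstantinIgnatovaVicol2026Putative, §3.4.1 eq. (3.22) (remark after)] -/
theorem volume_image_flow (hV : ContDiff ℝ ∞ V) {K : ℝ} (hK : ∀ y, ‖fderiv ℝ V y‖ ≤ K)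
    (hdiv : VectorCalculus.IsDivFree V) {s : ℝ} (hs : 0 ≤ s) {A : Set (EuclideanSpace ℝ (Fin 3))}
    (hAm : MeasurableSet A) :
    (volume (ODE.evolutionMap (fun _ : ℝ => selfSimilarTransport γ 0 V) 0 s '' A)).toReal =
      Real.exp (3 * γ * s) * (volume A).toReal := by
  have h := setIntegral_image_evolutionMap_eq (u := fun _ : ℝ => selfSimilarTransport γ 0 V)
    (isUniformlyLipschitzOn_transport hV hK) (isSmoothSpaceTimeOn_transport hV) convex_univ
    (mem_univ _) uniqueDiffOn_univ (mem_univ s) hAm (fun _ => (1 : ℝ))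
  simp only [integral_const, MeasurableSet.univ, measureReal_restrict_apply, univ_inter, smul_eq_mul,
    mul_one, one_mul] at h
  rw [measureReal_def] at h
  rw [h]
  have h2 : ∫ a in A, (fderiv ℝ (ODE.evolutionMap (fun _ : ℝ => selfSimilarTransport γ 0 V) 0 s) a).det
      = ∫ _ in A, Real.exp (3 * γ * s) :=
    setIntegral_congr_fun hAm fun a _ => det_fderiv_flow (γ := γ) hV hK hdiv hs a
  rw [h2, setIntegral_const, smul_eq_mul, mul_comm, measureReal_def]

/-- **Transport of an `L¹` quantity: `∫_A ‖V ∘ Φ_s‖ = e^{−3γs} ∫_{Φ_s(A)} ‖V‖`.**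
[cite: MajdaBertozziCUP2002, §1.3 proof of Prop. 1.3 (change of variables)] -/
theorem setIntegral_norm_comp_flow (hV : ContDiff ℝ ∞ V) {K : ℝ} (hK : ∀ y, ‖fderiv ℝ V y‖ ≤ K)
    (hdiv : VectorCalculus.IsDivFree V) {s : ℝ} (hs : 0 ≤ s) {A : Set (EuclideanSpace ℝ (Fin 3))}
    (hAm : MeasurableSet A) :
    ∫ a in A, ‖V (ODE.evolutionMap (fun _ : ℝ => selfSimilarTransport γ 0 V) 0 s a)‖ =
      Real.exp (-(3 * γ * s)) *
        ∫ x in ODE.evolutionMap (fun _ : ℝ => selfSimilarTransport γ 0 V) 0 s '' A, ‖V x‖ := by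
  have h := setIntegral_image_evolutionMap_eq (u := fun _ : ℝ => selfSimilarTransport γ 0 V)
    (isUniformlyLipschitzOn_transport hV hK) (isSmoothSpaceTimeOn_transport hV) convex_univ
    (mem_univ _) uniqueDiffOn_univ (mem_univ s) hAm (fun x => ‖V x‖)
  have h2 : ∫ a in A, ‖V (ODE.evolutionMap (fun _ : ℝ => selfSimilarTransport γ 0 V) 0 s a)‖ *
      (fderiv ℝ (ODE.evolutionMap (fun _ : ℝ => selfSimilarTransport γ 0 V) 0 s) a).det =
      Real.exp (3 * γ * s) *
        ∫ a in A, ‖V (ODE.evolutionMap (fun _ : ℝ => selfSimilarTransport γ 0 V) 0 s a)‖ := by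
    rw [← integral_const_mul]
    refine setIntegral_congr_fun hAm fun a _ => ?_
    rw [det_fderiv_flow (γ := γ) hV hK hdiv hs a, mul_comm]
  rw [h, h2, ← mul_assoc, ← Real.exp_add]
  simp


/-- Antitonicity of `x ↦ x^{−β}` on `(0, ∞)` for `β ≥ 0`. [folklore] -/
theorem rpow_neg_le_rpow_neg_of_le {x y β : ℝ} (hx : 0 < x) (hxy : x ≤ y) (hβ : 0 ≤ β) :
    y ^ (-β) ≤ x ^ (-β) := by
  rw [Real.rpow_neg hx.le, Real.rpow_neg (hx.le.trans hxy)]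
  exact inv_anti₀ (Real.rpow_pos_of_pos hx β) (Real.rpow_le_rpow hx.le hxy hβ)

/-- **The far-field Kelvin bound.** For a smooth bounded profile with `‖DV‖ ≤ ε` beyond the radius
`R`, a divergence-free test field `B` supported in `{|y| ≥ L}` with `L − M/γ ≥ R`, and the energy
of `V` on the transported support `Φ_s(supp B)` bounded by `C e^{−βγ s}`: 
`|∫ ⟪V, B⟫| ≤ ½ ‖B‖_∞ (C + vol(supp B)) · e^{(1 − 5γ/2 + ε − βγ/2)s}`
(Kelvin law + `‖DΦ_s‖ ≤ e^{(γ+ε)s}` + Jacobian `e^{3γs}` + AM–GM on the image).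
[cite: ConstantinIgnatovaVicol2026Putative, §3.4.2 Remark 3.6 (the exponent test, here at spatial infinity)] -/
theorem abs_integral_inner_le_exp_of_image (hγ : 0 < γ) (hV : ContDiff ℝ ∞ V) {K : ℝ}
    (hK : ∀ y, ‖fderiv ℝ V y‖ ≤ K) {M : ℝ} (hM : ∀ y, ‖V y‖ ≤ M)
    {P : EuclideanSpace ℝ (Fin 3) → ℝ} (hprof : IsSelfSimilarEulerProfile γ 0 V P)
    (hV2 : Integrable (fun x => ‖V x‖ ^ 2) volume)
    {ε R : ℝ} (hε : ∀ z : EuclideanSpace ℝ (Fin 3), R ≤ ‖z‖ → ‖fderiv ℝ V z‖ ≤ ε)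
    {L : ℝ} (hLR : R ≤ L - M / γ)
    {B : EuclideanSpace ℝ (Fin 3) → EuclideanSpace ℝ (Fin 3)} (hB : ContDiff ℝ ∞ B)
    (hBc : HasCompactSupport B) (hBdiv : VectorCalculus.IsDivFree B)
    (hBL : ∀ y ∈ tsupport B, L ≤ ‖y‖) {Bmax : ℝ} (hBmax : ∀ y, ‖B y‖ ≤ Bmax)
    {s : ℝ} (hs : 0 ≤ s) {β C : ℝ}
    (himg : ∫ x in ODE.evolutionMap (fun _ : ℝ => selfSimilarTransport γ 0 V) 0 s '' tsupport B,
      ‖V x‖ ^ 2 ≤ C * Real.exp (-(β * γ * s))) :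
    |∫ y, ⟪V y, B y⟫| ≤ Bmax * (C + (volume (tsupport B)).toReal) / 2 *
      Real.exp ((1 - 5 * γ / 2 + ε - β * γ / 2) * s) := by
  set Φ := ODE.evolutionMap (fun _ : ℝ => selfSimilarTransport γ 0 V) 0 with hΦ
  set T := tsupport B with hT
  have hTc : IsCompact T := hBc
  have hTm : MeasurableSet T := hTc.measurableSet
  have hBmax0 : 0 ≤ Bmax := (norm_nonneg _).trans (hBmax 0)
  have hdiv : VectorCalculus.IsDivFree V := hprof.divFree
  have hΦc : Continuous (Φ s) := (contDiff_flow (γ := γ) hV hK s).continuous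
  have hVc : Continuous V := hV.continuous
  -- (1) Kelvin
  have hKel := integral_inner_flow_eq_exp_mul (γ := γ) hV hK hprof hB hBc hBdiv s
  rw [← hΦ] at hKel
  -- (2) the integrand of `Q(s)` is bounded by `e^{(γ+ε)s} Bmax ‖V ∘ Φ_s‖` on `T` and vanishes off `T`
  have hJ : ∀ y ∈ T, ‖fderiv ℝ (Φ s) y‖ ≤ Real.exp ((γ + ε) * s) := fun y hy =>
    norm_fderiv_flow_le_exp (γ := γ) hV hK hM hγ hε (hLR.trans (by linarith [hBL y hy])) hs
  have hpt : ∀ y ∈ T, |⟪V (Φ s y), fderiv ℝ (Φ s) y (B y)⟫| ≤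
      ‖V (Φ s y)‖ * (Real.exp ((γ + ε) * s) * Bmax) := by
    intro y hy
    refine (abs_real_inner_le_norm _ _).trans (mul_le_mul_of_nonneg_left ?_ (norm_nonneg _))
    exact (ContinuousLinearMap.le_opNorm _ _).trans
      (mul_le_mul (hJ y hy) (hBmax y) (norm_nonneg _) (Real.exp_pos _).le)
  have hzero : ∀ y ∉ T, ⟪V (Φ s y), fderiv ℝ (Φ s) y (B y)⟫ = 0 := by
    intro y hy
    rw [hT] at hy
    simp [image_eq_zero_of_notMem_tsupport hy]
  have hcontF : Continuous fun y => ⟪V (Φ s y), fderiv ℝ (Φ s) y (B y)⟫ :=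
    (hVc.comp hΦc).inner (((contDiff_flow (γ := γ) hV hK s).continuous_fderiv (by simp)).clm_apply
      hB.continuous)
  have hQ : |∫ y, ⟪V (Φ s y), fderiv ℝ (Φ s) y (B y)⟫| ≤
      Real.exp ((γ + ε) * s) * Bmax * ∫ y in T, ‖V (Φ s y)‖ := by
    rw [← setIntegral_eq_integral_of_forall_compl_eq_zero (s := T) (fun y hy => hzero y hy)]
    refine (abs_integral_le_integral_abs).trans ?_
    calc ∫ y in T, |⟪V (Φ s y), fderiv ℝ (Φ s) y (B y)⟫|
        ≤ ∫ y in T, ‖V (Φ s y)‖ * (Real.exp ((γ + ε) * s) * Bmax) := by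
          refine setIntegral_mono_on ?_ ?_ hTm hpt
          · exact (continuous_abs.comp hcontF).continuousOn.integrableOn_compact hTc
          · exact ((hVc.comp hΦc).norm.mul continuous_const).continuousOn.integrableOn_compact hTc
      _ = Real.exp ((γ + ε) * s) * Bmax * ∫ y in T, ‖V (Φ s y)‖ := by
          rw [integral_mul_const]; ring
  -- (3) transport: `∫_T ‖V ∘ Φ_s‖ = e^{−3γs} ∫_{Φ_s T} ‖V‖`
  have htrans := setIntegral_norm_comp_flow (γ := γ) hV hK hdiv hs hTm
  rw [← hΦ] at htrans
  -- (4) AM–GM on the image, which has volume `e^{3γs} vol T`, with `l = e^{(3γ/2 + βγ/2)s}`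
  have hAc : IsCompact (Φ s '' T) := hTc.image hΦc
  have hAm : MeasurableSet (Φ s '' T) := hAc.measurableSet
  have hvol := volume_image_flow (γ := γ) hV hK hdiv hs hTm
  rw [← hΦ] at hvol
  set l : ℝ := Real.exp ((3 * γ / 2 + β * γ / 2) * s) with hl
  have hl0 : 0 < l := Real.exp_pos _
  have hI1 : IntegrableOn (fun x => ‖V x‖) (Φ s '' T) volume :=
    hVc.norm.continuousOn.integrableOn_compact hAc
  have hI2 : IntegrableOn (fun x => ‖V x‖ ^ 2) (Φ s '' T) volume := hV2.integrableOn
  have hAM : (∫ x in Φ s '' T, ‖V x‖) ≤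
      (l * (∫ x in Φ s '' T, ‖V x‖ ^ 2) + l⁻¹ * (volume (Φ s '' T)).toReal) / 2 := by
    have hmono : (∫ x in Φ s '' T, ‖V x‖) ≤ ∫ x in Φ s '' T, (l * ‖V x‖ ^ 2 + l⁻¹) / 2 :=
      setIntegral_mono_on hI1 (((hI2.const_mul l).add (integrableOn_const hAc.measure_lt_top.ne)).div_const 2)
        hAm fun x _ => norm_le_half_mul_sq_add_inv hl0
    refine hmono.trans (le_of_eq ?_)
    rw [integral_div, integral_add (hI2.const_mul l) (integrableOn_const hAc.measure_lt_top.ne),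
      integral_const_mul, setIntegral_const, smul_eq_mul, mul_comm _ l⁻¹, measureReal_def]
  have himage : (∫ x in Φ s '' T, ‖V x‖) ≤
      (C + (volume T).toReal) / 2 * Real.exp ((3 * γ / 2 - β * γ / 2) * s) := by
    refine hAM.trans ?_
    rw [hvol]
    have h1 : l * (∫ x in Φ s '' T, ‖V x‖ ^ 2) ≤ C * Real.exp ((3 * γ / 2 - β * γ / 2) * s) := by
      refine (mul_le_mul_of_nonneg_left himg hl0.le).trans (le_of_eq ?_)
      rw [hl, mul_left_comm, ← Real.exp_add]; ring_nf
    have h2 : l⁻¹ * (Real.exp (3 * γ * s) * (volume T).toReal) =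
        (volume T).toReal * Real.exp ((3 * γ / 2 - β * γ / 2) * s) := by
      rw [hl, ← Real.exp_neg, ← mul_assoc, ← Real.exp_add]; ring_nf
    rw [h2]
    linarith [h1]
  -- (5) assemble
  have hI : ∫ y, ⟪V y, B y⟫ = Real.exp (-((2 * γ - 1) * s)) *
      ∫ y, ⟪V (Φ s y), fderiv ℝ (Φ s) y (B y)⟫ := by
    rw [hKel, ← mul_assoc, ← Real.exp_add]; simp
  rw [hI, abs_mul, abs_of_pos (Real.exp_pos _)]
  calc Real.exp (-((2 * γ - 1) * s)) * |∫ y, ⟪V (Φ s y), fderiv ℝ (Φ s) y (B y)⟫|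
      ≤ Real.exp (-((2 * γ - 1) * s)) * (Real.exp ((γ + ε) * s) * Bmax *
          (Real.exp (-(3 * γ * s)) * ((C + (volume T).toReal) / 2 *
            Real.exp ((3 * γ / 2 - β * γ / 2) * s)))) := by
        refine mul_le_mul_of_nonneg_left (hQ.trans ?_) (Real.exp_pos _).le
        rw [htrans]
        exact mul_le_mul_of_nonneg_left (mul_le_mul_of_nonneg_left himage (Real.exp_pos _).le)
          (mul_nonneg (Real.exp_pos _).le hBmax0)
    _ = Bmax * (C + (volume T).toReal) / 2 *
          Real.exp ((1 - 5 * γ / 2 + ε - β * γ / 2) * s) := by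
        have : Real.exp ((1 - 5 * γ / 2 + ε - β * γ / 2) * s) =
            Real.exp (-((2 * γ - 1) * s)) * Real.exp ((γ + ε) * s) * Real.exp (-(3 * γ * s)) *
              Real.exp ((3 * γ / 2 - β * γ / 2) * s) := by
          rw [← Real.exp_add, ← Real.exp_add, ← Real.exp_add]; ring_nf
        rw [this]; ring

/-- **The transported support lives in a dyadic annulus of fixed width**: if `supp B ⊆ B̄(0, L')`,
`supp B ⊆ {|y| ≥ L}`, `ℓ = L − M/γ > 0` and `L' + M/γ < 2^N ℓ`, then
`Φ_s(supp B) ⊆ {x | ℓ e^{γs} ≤ |x| < 2^N ℓ e^{γs}}` for `s ≥ 0`.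
[cite: ConstantinIgnatovaVicol2026Putative, §3.4.1 eq. (3.21)] -/
theorem image_subset_annulus (hV : ContDiff ℝ ∞ V) {K : ℝ} (hK : ∀ y, ‖fderiv ℝ V y‖ ≤ K)
    {M : ℝ} (hM : ∀ y, ‖V y‖ ≤ M) (hγ : 0 < γ) {s : ℝ} (hs : 0 ≤ s)
    {T : Set (EuclideanSpace ℝ (Fin 3))} {L L' : ℝ} (hTL : ∀ y ∈ T, L ≤ ‖y‖)
    (hTL' : ∀ y ∈ T, ‖y‖ ≤ L') {N : ℕ} (hN : L' + M / γ < 2 ^ N * (L - M / γ)) :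
    ODE.evolutionMap (fun _ : ℝ => selfSimilarTransport γ 0 V) 0 s '' T ⊆
      {x | (L - M / γ) * Real.exp (γ * s) ≤ ‖x‖ ∧
        ‖x‖ < 2 ^ N * ((L - M / γ) * Real.exp (γ * s))} := by
  rintro x ⟨y, hy, rfl⟩
  have h1 := norm_flow_ge (γ := γ) hV hK hM hγ hs y
  have h2 := norm_flow_le (γ := γ) hV hK hM hγ hs y
  refine ⟨?_, ?_⟩
  · calc (L - M / γ) * Real.exp (γ * s) ≤ (‖y‖ - M / γ) * Real.exp (γ * s) :=
          mul_le_mul_of_nonneg_right (by linarith [hTL y hy]) (Real.exp_pos _).le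
      _ = Real.exp (γ * s) * (‖y‖ - M / γ) := mul_comm _ _
      _ ≤ _ := h1
  · calc ‖ODE.evolutionMap (fun _ : ℝ => selfSimilarTransport γ 0 V) 0 s y‖
        ≤ Real.exp (γ * s) * (‖y‖ + M / γ) := h2
      _ ≤ Real.exp (γ * s) * (L' + M / γ) :=
          mul_le_mul_of_nonneg_left (by linarith [hTL' y hy]) (Real.exp_pos _).le
      _ < Real.exp (γ * s) * (2 ^ N * (L - M / γ)) :=
          mul_lt_mul_of_pos_left hN (Real.exp_pos _)
      _ = 2 ^ N * ((L - M / γ) * Real.exp (γ * s)) := by ring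

end Summit.NavierStokesRegularity.NavierStokesRegularity.Theorems.PowerGaugeEulerLiouville.Kelvin

end
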